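import Literature.NumberTheory.EllipticCurves.RankinSelbergWeightOneEisensteinPair
import Literature.NumberTheory.EllipticCurves.ModularityVersionAp
import Literature.NumberTheory.LFunctions.RankinEisensteinFactorisation
import HarnessLib

/-!
# The Rankin–Selberg Dirichlet series of a newform against a weight-one Eisenstein series:
`Σ a(m) \overline{b(m)} m^{-w} = \bar κ · L(f, w) L(f ⊗ χ, w) / L(χ_N, 2w - 1)`

Topic `Literature/NumberTheory/EllipticCurves`; namespace
`Literature.NumberTheory.EllipticCurves.ModularForms`. One definition with a body (`levelWeight`,
the completely multiplicative weight `ν(n) = n · 𝟙[(n, N) = 1]`) and theorems; no named fact.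

For a newform `f ∈ S₂(Γ₀(N))` (`IsNewform0 f`: normalised Hecke eigenform in the new subspace;
coefficients `a = cuspCoeff f`, multiplicative with `a_{p^{e+2}} = a_p a_{p^{e+1}} - 𝟙_N(p) p a_{p^e}`,
tree `IsNewform0.coeff_mul_of_coprime_holds`, `IsNewform0.cuspCoeff_prime_pow_add_two`) and a
Dirichlet character `χ mod M`, the Dirichlet series appearing in the Rankin–Selberg identity
`rankinSelberg_eisensteinPair_eq_tsum` (with `b = eisensteinOneZeroCoeff χ`, the `q`-coefficients of
`G̃_χ(·, 0)`) factors: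

* `conj_eisensteinOneZeroCoeff_succ` — `\overline{b(m)} = \bar κ σ_χ(m)` for `m ≥ 1`,
  `κ = -4πiτ(χ)/M`, `σ_χ(m) = Σ_{d ∣ m} χ(d)` (`twistedDivisorSum`);
* `tsum_mul_conj_eisensteinOneZeroCoeff_eq_LSeries` —
  `Σ_{m ≥ 1} a(m) \overline{b(m)} (4πm)^{-w} = \bar κ (4π)^{-w} L(a σ_χ, w)` (`Re w > 4`);
* `LSeries_mul_twistedDivisorSum_of_recursion` — Rankin's factorisation from `a(0)=0`, `a(1)=1`,
  coprime multiplicativity, the weight-`2` recursion with `ν = levelWeight N₀` and a polynomial bound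
  (so it applies to a newform viewed at any higher level);
* `LSeries_cuspCoeff_mul_twistedDivisorSum` — **Rankin's factorisation for a newform**:
  `L(a σ_χ, w) · L(χν, 2w) = L(f, w) · L(f ⊗ χ, w)` for `Re w > 4`
  (`Literature.NumberTheory.LFunctions.RankinEisenstein.LSeries_mul_twistedDivisorSum_dirichlet`
  with `ν = levelWeight N`; here `L(χν, 2w) = Σ_{(n,N)=1} χ(n) n^{1-2w} = L(χ_N, 2w - 1)`).

So, for `Re s` large, the right-hand side of `rankinSelberg_eisensteinPair_eq_tsum` is
`\overline{L(ψ, 1+2s̄)} · 2Γ(s+1) \bar κ (4π)^{-(s+1)} L(f, s+1) L(f ⊗ χ, s+1) / L(χ_N, 2s+1)`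
(Rankin 1939; Shimura 1976, Lemma 1 and (2.4); Gross 1987, §5). Everything is proved. [folklore]

## References

* R. A. Rankin, Proc. Cambridge Philos. Soc. 35 (1939), 357–372.
* G. Shimura, Comm. Pure Appl. Math. 29 (1976), 783–804, Lemma 1, (2.4).
* B. H. Gross, *Heights and the special values of L-series*, CMS Conf. Proc. 7 (1987), §5.
-/

noncomputable section

open scoped ComplexConjugate Real
open Complex CongruenceSubgroup
open Literature.NumberTheory.LFunctions.RankinEisenstein (twistedDivisorSum twistedDivisorSum_apply
  LSeries_mul_twistedDivisorSum_dirichlet)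

namespace Literature.NumberTheory.EllipticCurves.ModularForms

/-! ### The level weight `ν(n) = n 𝟙[(n, N) = 1]` -/

/-- The completely multiplicative weight `ν(n) = n` if `(n, N) = 1`, `0` otherwise; at a prime
`ν(p) = 𝟙[p ∤ N] p`, the second coefficient of the Hecke polynomial in weight `2`. [folklore] -/
def levelWeight (N : ℕ) (n : ℕ) : ℂ := if n.Coprime N then (n : ℂ) else 0

/-- `ν(1) = 1`. [folklore] -/
theorem levelWeight_one (N : ℕ) : levelWeight N 1 = 1 := by
  simp [levelWeight]

/-- `ν` is completely multiplicative. [folklore] -/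
theorem levelWeight_mul (N m n : ℕ) : levelWeight N (m * n) = levelWeight N m * levelWeight N n := by
  unfold levelWeight
  by_cases hm : m.Coprime N
  · by_cases hn : n.Coprime N
    · rw [if_pos (Nat.Coprime.mul_left hm hn), if_pos hm, if_pos hn, Nat.cast_mul]
    · rw [if_neg (fun h => hn (Nat.Coprime.coprime_mul_left h)), if_neg hn, mul_zero]
  · rw [if_neg (fun h => hm (Nat.Coprime.coprime_mul_right h)), if_neg hm, zero_mul]

/-- `ν(p) = 𝟙[p ∤ N] p` at a prime. [folklore] -/
theorem levelWeight_prime {N p : ℕ} (hp : p.Prime) :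
    levelWeight N p = if p ∣ N then 0 else (p : ℂ) := by
  unfold levelWeight
  by_cases h : p ∣ N
  · rw [if_pos h, if_neg]
    exact fun hc => hp.one_lt.ne' (Nat.Coprime.eq_one_of_dvd hc h)
  · rw [if_neg h, if_pos ((Nat.Prime.coprime_iff_not_dvd hp).mpr h)]

/-- `|ν(n)| ≤ n`. [folklore] -/
theorem norm_levelWeight_le (N n : ℕ) : ‖levelWeight N n‖ ≤ n := by
  unfold levelWeight
  split_ifs
  · rw [Complex.norm_natCast]
  · rw [norm_zero]; exact Nat.cast_nonneg n

/-! ### The coefficients of the cusp form as a multiplicative arithmetic function -/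

section Newform

variable {N : ℕ} [NeZero N]

omit [NeZero N] in
/-- `toArithmeticFunction (cuspCoeff f)` is `cuspCoeff f` (the latter vanishes at `0`). [folklore] -/
theorem coe_toArithmeticFunction_cuspCoeff {k : ℤ} (f : CuspForm (Gamma0 N) k) :
    (⇑(toArithmeticFunction (cuspCoeff f)) : ℕ → ℂ) = cuspCoeff f := by
  funext n
  rcases Nat.eq_zero_or_pos n with rfl | hn
  · simp [toArithmeticFunction, cuspCoeff_zero_eq]
  · simp [toArithmeticFunction, hn.ne']

/-- For a newform the coefficient sequence is a multiplicative arithmetic function. [folklore] -/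
theorem isMultiplicative_cuspCoeff {k : ℤ} {f : CuspForm (Gamma0 N) k} (hf : IsNewform0 f) :
    (toArithmeticFunction (cuspCoeff f)).IsMultiplicative := by
  refine ⟨?_, fun {m} {n} hmn => ?_⟩
  · rw [coe_toArithmeticFunction_cuspCoeff]
    exact hf.2.2
  · rw [coe_toArithmeticFunction_cuspCoeff]
    exact IsNewform0.coeff_mul_of_coprime_holds hf hmn

/-- The weight-`2` prime-power recursion with `ν = levelWeight N`. [folklore] -/
theorem cuspCoeff_prime_pow_add_two_levelWeight {f : CuspForm (Gamma0 N) 2} (hf : IsNewform0 f)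
    (p : ℕ) (hp : p.Prime) (e : ℕ) :
    (toArithmeticFunction (cuspCoeff f)) (p ^ (e + 2)) =
      (toArithmeticFunction (cuspCoeff f)) p * (toArithmeticFunction (cuspCoeff f)) (p ^ (e + 1)) -
        levelWeight N p * (toArithmeticFunction (cuspCoeff f)) (p ^ e) := by
  simp only [coe_toArithmeticFunction_cuspCoeff, levelWeight_prime hp]
  exact hf.cuspCoeff_prime_pow_add_two hp e

/-! ### Summability -/

/-- A sequence with `|c(n)| ≤ C (n+1)^k` has absolutely convergent `L`-series for `Re w > k + 1`.
[folklore] -/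
theorem LSeriesSummable_of_norm_le_pow {c : ℕ → ℂ} {C : ℝ} {k : ℕ}
    (hc : ∀ n, ‖c n‖ ≤ C * ((n : ℝ) + 1) ^ k) {w : ℂ} (hw : (k : ℝ) + 1 < w.re) :
    LSeriesSummable c w := by
  have hC : 0 ≤ C := by
    have h := hc 0
    simp only [Nat.cast_zero, zero_add, one_pow, mul_one] at h
    exact (norm_nonneg _).trans h
  refine LSeriesSummable_of_le_const_mul_rpow hw ⟨C * 2 ^ k, fun n hn => ?_⟩
  have hn1 : (1 : ℝ) ≤ n := by exact_mod_cast Nat.one_le_iff_ne_zero.mpr hn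
  rw [show (k : ℝ) + 1 - 1 = (k : ℕ) from by ring, Real.rpow_natCast]
  calc ‖c n‖ ≤ C * ((n : ℝ) + 1) ^ k := hc n
    _ ≤ C * ((2 * n) ^ k) := by
        refine mul_le_mul_of_nonneg_left (pow_le_pow_left₀ (by positivity) (by linarith) k) hC
    _ = C * 2 ^ k * (n : ℝ) ^ k := by rw [mul_pow]; ring

/-- `|σ_χ(n)| ≤ n + 1` for a Dirichlet character. [folklore] -/
theorem norm_twistedDivisorSum_le {M : ℕ} (χ : DirichletCharacter ℂ M) (n : ℕ) :
    ‖twistedDivisorSum (fun m : ℕ => χ m) n‖ ≤ (n : ℝ) + 1 := by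
  rw [twistedDivisorSum_apply]
  calc ‖∑ d ∈ n.divisors, χ (d : ZMod M)‖ ≤ ∑ d ∈ n.divisors, ‖χ (d : ZMod M)‖ := norm_sum_le _ _
    _ ≤ ∑ _d ∈ n.divisors, (1 : ℝ) := Finset.sum_le_sum fun d _ => χ.norm_le_one _
    _ = n.divisors.card := by simp
    _ ≤ n := by exact_mod_cast Nat.card_divisors_le_self n
    _ ≤ (n : ℝ) + 1 := by linarith

/-! ### The factorisation -/

/-- `toArithmeticFunction a` is `a` when `a 0 = 0`. [folklore] -/
theorem coe_toArithmeticFunction_of_map_zero {a : ℕ → ℂ} (ha0 : a 0 = 0) :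
    (⇑(toArithmeticFunction a) : ℕ → ℂ) = a := by
  funext n
  rcases Nat.eq_zero_or_pos n with rfl | hn
  · simp [toArithmeticFunction, ha0]
  · simp [toArithmeticFunction, hn.ne']

omit [NeZero N] in
/-- **Rankin's factorisation from multiplicativity and the weight-`2` Hecke recursion**: for
`a : ℕ → ℂ` with `a(0) = 0`, `a(1) = 1`, `a(mn) = a(m)a(n)` for `(m, n) = 1`,
`a(p^{e+2}) = a(p) a(p^{e+1}) - ν(p) a(p^e)` with `ν = levelWeight N₀` (any level `N₀`), and
`|a(m)| ≤ C (m+1)²`, a Dirichlet character `χ mod M`, and `Re w > 4`: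
`L(a σ_χ, w) · L(χν, 2w) = L(a, w) · L(a χ, w)`. (The coefficients of a weight-`2` newform of level
`N₀`, also when the form is viewed at a higher level, satisfy these hypotheses.) [folklore] -/
theorem LSeries_mul_twistedDivisorSum_of_recursion {a : ℕ → ℂ} (ha0 : a 0 = 0) (ha1 : a 1 = 1)
    (hmul : ∀ {m n : ℕ}, m.Coprime n → a (m * n) = a m * a n) {N₀ : ℕ}
    (hrec : ∀ p : ℕ, p.Prime → ∀ e : ℕ,
      a (p ^ (e + 2)) = a p * a (p ^ (e + 1)) - levelWeight N₀ p * a (p ^ e))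
    {Ca : ℝ} (ha : ∀ m, ‖a m‖ ≤ Ca * ((m : ℝ) + 1) ^ 2)
    {M : ℕ} (χ : DirichletCharacter ℂ M) {w : ℂ} (hw : 4 < w.re) :
    LSeries (a * twistedDivisorSum (fun n : ℕ => χ n)) w *
        LSeries ((fun n : ℕ => χ n) * levelWeight N₀) (2 * w) =
      LSeries a w * LSeries (a * fun n : ℕ => χ n) w := by
  have hCa0 : 0 ≤ Ca := by
    have h := ha 0
    simp only [Nat.cast_zero, zero_add, one_pow, mul_one] at h
    exact (norm_nonneg _).trans h
  -- summability of the four series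
  have h₁ : LSeriesSummable (a * twistedDivisorSum (fun n : ℕ => χ n)) w := by
    refine LSeriesSummable_of_norm_le_pow (C := Ca) (k := 3) (fun n => ?_) (by push_cast; linarith)
    rw [Pi.mul_apply, norm_mul]
    calc ‖a n‖ * ‖twistedDivisorSum (fun m : ℕ => χ m) n‖
        ≤ Ca * ((n : ℝ) + 1) ^ 2 * ((n : ℝ) + 1) :=
          mul_le_mul (ha n) (norm_twistedDivisorSum_le χ n) (norm_nonneg _) (by positivity)
      _ = Ca * ((n : ℝ) + 1) ^ 3 := by ring
  have h₂ : LSeriesSummable ((fun n : ℕ => χ n) * levelWeight N₀) (2 * w) := by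
    refine LSeriesSummable_of_norm_le_pow (C := 1) (k := 1) (fun n => ?_) ?_
    · rw [Pi.mul_apply, norm_mul, one_mul, pow_one]
      calc ‖χ (n : ZMod M)‖ * ‖levelWeight N₀ n‖ ≤ 1 * n :=
            mul_le_mul (χ.norm_le_one _) (norm_levelWeight_le N₀ n) (norm_nonneg _) zero_le_one
        _ ≤ (n : ℝ) + 1 := by linarith
    · simp only [Complex.mul_re, Complex.re_ofNat, Complex.im_ofNat, zero_mul, sub_zero]
      push_cast
      linarith
  have h₃ : LSeriesSummable a w :=
    LSeriesSummable_of_norm_le_pow ha (by push_cast; linarith)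
  have h₄ : LSeriesSummable (a * fun n : ℕ => χ n) w := by
    refine LSeriesSummable_of_norm_le_pow (C := Ca) (k := 2) (fun n => ?_) (by push_cast; linarith)
    rw [Pi.mul_apply, norm_mul]
    calc ‖a n‖ * ‖χ (n : ZMod M)‖ ≤ Ca * ((n : ℝ) + 1) ^ 2 * 1 :=
          mul_le_mul (ha n) (χ.norm_le_one _) (norm_nonneg _) (by positivity)
      _ = Ca * ((n : ℝ) + 1) ^ 2 := mul_one _
  have hcoe := coe_toArithmeticFunction_of_map_zero ha0
  have hmult : (toArithmeticFunction a).IsMultiplicative := by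
    refine ⟨?_, fun {m} {n} hmn => ?_⟩
    · rw [hcoe]; exact ha1
    · rw [hcoe]; exact hmul hmn
  have h := LSeries_mul_twistedDivisorSum_dirichlet (a := toArithmeticFunction a)
    (ν := levelWeight N₀) χ hmult (fun p hp e => by rw [hcoe]; exact hrec p hp e)
    (levelWeight_one N₀) (levelWeight_mul N₀)
    (by rwa [hcoe]) h₂ (by rwa [hcoe]) (by rwa [hcoe])
  rwa [hcoe] at h

/-- **Rankin's factorisation for a newform of weight `2`**: for `f ∈ S₂(Γ₀(N))` a newform with
coefficients `a`, a Dirichlet character `χ mod M`, and `Re w > 4`,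
`L(a σ_χ, w) · L(χ ν, 2w) = L(f, w) · L(f ⊗ χ, w)`, `σ_χ(n) = Σ_{d ∣ n} χ(d)`,
`ν(n) = n 𝟙[(n, N) = 1]` (so `L(χν, 2w) = L(χ_N, 2w - 1)`). [folklore] -/
theorem LSeries_cuspCoeff_mul_twistedDivisorSum {f : CuspForm (Gamma0 N) 2} (hf : IsNewform0 f)
    {M : ℕ} (χ : DirichletCharacter ℂ M) {w : ℂ} (hw : 4 < w.re) :
    LSeries (cuspCoeff f * twistedDivisorSum (fun n : ℕ => χ n)) w *
        LSeries ((fun n : ℕ => χ n) * levelWeight N) (2 * w) =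
      LSeries (cuspCoeff f) w * LSeries (cuspCoeff f * fun n : ℕ => χ n) w := by
  obtain ⟨Ca, hCa⟩ := exists_norm_cuspCoeff_le f (k := 2) (by norm_num)
  have ha : ∀ m, ‖cuspCoeff f m‖ ≤ Ca * ((m : ℝ) + 1) ^ 2 := fun m => by simpa using hCa m
  refine LSeries_mul_twistedDivisorSum_of_recursion (cuspCoeff_zero_eq f) hf.2.2
    (fun hmn => IsNewform0.coeff_mul_of_coprime_holds hf hmn)
    (fun p hp e => ?_) ha χ hw
  rw [levelWeight_prime hp]
  exact hf.cuspCoeff_prime_pow_add_two hp e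

end Newform

/-! ### The Rankin–Selberg Dirichlet series as an `L`-series -/

section Series

variable {M : ℕ} [NeZero M] (χ : DirichletCharacter ℂ M)

omit [NeZero M] in
/-- `\overline{χ⁻¹(d)} = χ(d)`. [folklore] -/
theorem conj_inv_apply (d : ZMod M) : conj (χ⁻¹ d) = χ d := by
  have h := MulChar.star_apply' χ⁻¹ d
  rw [inv_inv] at h
  exact h

/-- **`\overline{b(m)} = \bar κ σ_χ(m)`** for `m ≥ 1`, `κ = -4πiτ(χ)/M`. [folklore] -/
theorem conj_eisensteinOneZeroCoeff_succ (m : ℕ) :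
    conj (eisensteinOneZeroCoeff χ (m + 1)) =
      conj (-(4 * π * Complex.I * gaussSum χ (ZMod.stdAddChar (N := M)) / M)) *
        twistedDivisorSum (fun n : ℕ => χ n) (m + 1) := by
  simp only [eisensteinOneZeroCoeff, Nat.succ_ne_zero, if_false, map_mul, map_sum,
    twistedDivisorSum_apply, conj_inv_apply]

/-- **The Rankin–Selberg Dirichlet series as an `L`-series**: for `|a(m)| ≤ C (m+1)²` and
`Re w > 4`, `Σ_{m ≥ 1} a(m) \overline{b(m)} (4πm)^{-w} = \bar κ · (4π)^{-w} · L(a σ_χ, w)`.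
[folklore] -/
theorem tsum_mul_conj_eisensteinOneZeroCoeff_eq_LSeries {a : ℕ → ℂ} {Ca : ℝ}
    (ha : ∀ m, ‖a m‖ ≤ Ca * ((m : ℝ) + 1) ^ 2) {w : ℂ} (hw : 4 < w.re) :
    ∑' m : ℕ, a (m + 1) * conj (eisensteinOneZeroCoeff χ (m + 1)) *
        (1 / ((4 * π * ((m : ℝ) + 1) : ℝ) : ℂ)) ^ w =
      conj (-(4 * π * Complex.I * gaussSum χ (ZMod.stdAddChar (N := M)) / M)) *
        (((1 / (4 * π) : ℝ) : ℂ) ^ w *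
          LSeries (a * twistedDivisorSum (fun n : ℕ => χ n)) w) := by
  set κ : ℂ := conj (-(4 * π * Complex.I * gaussSum χ (ZMod.stdAddChar (N := M)) / M)) with hκ
  set g : ℕ → ℂ := a * twistedDivisorSum (fun n : ℕ => χ n) with hg
  have hsum : LSeriesSummable g w := by
    refine LSeriesSummable_of_norm_le_pow (C := Ca) (k := 3) (fun n => ?_) (by push_cast; linarith)
    rw [hg, Pi.mul_apply, norm_mul]
    calc ‖a n‖ * ‖twistedDivisorSum (fun m : ℕ => χ m) n‖
        ≤ Ca * ((n : ℝ) + 1) ^ 2 * ((n : ℝ) + 1) :=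
          mul_le_mul (ha n) (norm_twistedDivisorSum_le χ n) (norm_nonneg _) (by
            have h := ha 0
            simp only [Nat.cast_zero, zero_add, one_pow, mul_one] at h
            have : 0 ≤ Ca := (norm_nonneg _).trans h
            positivity)
      _ = Ca * ((n : ℝ) + 1) ^ 3 := by ring
  -- the `L`-series as a sum over `m + 1`
  have hL : LSeries g w = ∑' m : ℕ, g (m + 1) * ((((m : ℝ) + 1)⁻¹ : ℝ) : ℂ) ^ w := by
    rw [LSeries, hsum.tsum_eq_zero_add, LSeries.term_zero, zero_add]
    refine tsum_congr fun m => ?_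
    rw [LSeries.term_of_ne_zero (Nat.succ_ne_zero m), div_eq_mul_inv]
    congr 1
    have hpos : (0 : ℝ) < (m : ℝ) + 1 := by positivity
    rw [Complex.ofReal_inv, Complex.inv_cpow _ _ (by
      rw [show (((m : ℝ) + 1 : ℝ) : ℂ) = ((m + 1 : ℕ) : ℂ) by push_cast; ring]
      exact (Complex.natCast_arg (n := m + 1)).symm ▸ Real.pi_pos.ne)]
    push_cast
    ring_nf
  rw [hL, ← tsum_mul_left, ← tsum_mul_left]
  refine tsum_congr fun m => ?_
  have hpos : (0 : ℝ) < (m : ℝ) + 1 := by positivity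
  have hsplit : (1 / ((4 * π * ((m : ℝ) + 1) : ℝ) : ℂ)) ^ w =
      (((1 / (4 * π) : ℝ) : ℂ)) ^ w * ((((m : ℝ) + 1)⁻¹ : ℝ) : ℂ) ^ w := by
    rw [← Complex.mul_cpow_ofReal_nonneg (by positivity) (by positivity) w]
    congr 1
    push_cast
    field_simp
  rw [hsplit, conj_eisensteinOneZeroCoeff_succ, hg, Pi.mul_apply]
  ring

end Series

end Literature.NumberTheory.EllipticCurves.ModularForms
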